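import Summits.AtomisticToContinuum.Crystallization.Theses.PalmUnimodularRigidity
import Summits.AtomisticToContinuum.Crystallization.Theorems.ChargedEnergyGap.Negative.BlocksBound
import Literature.MathematicalPhysics.StatisticalMechanics.BarlowCoordination
import Literature.Barriers.AtomisticToContinuum.HcpNotBravais

/-!
# Negative knowledge for crux `LayeredLawsSelectHcp` (stmt-AtomisticToContinuum-9226), I:
# the crux unbundled; Dirac laws at counting measures; lattice Palm laws are point-stationary

Standing crux disprover (cdisprove, gen 1), `--supports stmt-AtomisticToContinuum-9226`; part I of
four (`DiracLaws` → `IntegerForms` → `FccLattice` → `FccModel`). The crux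
`PalmUnimodularRigidity.LayeredLawsSelectHcp` is unbundled DEFINITIONALLY: `crux_iff : … ↔ ∀ δ > 0, ∀ P,
IsProbabilityMeasure P → Rooted δ P → PointStationary P → meanRootEnergy P ≤ e* → Layered P →
∀ᵐ μ ∂P, IsRelaxedHcp μ` is `Iff.rfl` (part IV refutes the same statement with the energy hypothesis
H3 deleted). Plumbing for "read one sample" arguments, which the route
needs everywhere and for which no `MeasurableSingletonClass (Measure ℝ³)` is available: for countable
`S ⊂ ℝ³` the singleton `{count|S}` IS a measurable set of measures
(`measurableSet_singleton_count_restrict`: cut out by the countably many conditions `μ Sᶜ = 0`,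
`μ {x} = 1`), whence `ae_dirac_of_mem`, `of_ae_dirac`, `lintegral_dirac_of_mem`, `integral_dirac_of_mem`.
And the first family of laws satisfying the crux's Mecke / mass-transport identity H2 verbatim: **the
Dirac law at `count|L` for every countable additive subgroup `L` of `ℝ³`**
(`pointStationary_dirac_addSubgroup`; shift-invariance of `count|L` on `L` and `L = −L`, through
`map_count_restrict_eq` and `lintegral_map_equiv`). All `[folklore]`.
-/

noncomputable section

namespace Summit.AtomisticToContinuum.Crystallization.Theorems.LayeredLawsSelectHcp.Negative.DiracLaws

open MeasureTheory Set
open Literature.MathematicalPhysics.StatisticalMechanics Literature.Geometry.DiscreteGeometry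
open Summit.AtomisticToContinuum.Crystallization.Theses.PalmUnimodularRigidity (LayeredLawsSelectHcp)
open Summit.AtomisticToContinuum.Crystallization.Theorems.ChargedEnergyGapNegative
  (eStar eStar_le bddBelow_energyPerParticle_lennardJones)

/-- Euclidean `3`-space. [folklore] -/
local notation "E3" => EuclideanSpace ℝ (Fin 3)

/-! ## §0 The crux unbundled -/

/-- H1 (`Rooted δ P`): `P`-a.s. the configuration is the counting measure of a `δ`-separated set
containing the root `0`. [folklore] -/
def Rooted (δ : ℝ) (P : Measure (Measure E3)) : Prop :=
  ∀ᵐ μ ∂P, ∃ S : Set E3, (0 : E3) ∈ S ∧ (∀ x ∈ S, ∀ y ∈ S, x ≠ y → δ ≤ dist x y) ∧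
    μ = (Measure.count : Measure E3).restrict S

/-- H2 (`PointStationary P`): the Mecke / mass-transport identity. [folklore] -/
def PointStationary (P : Measure (Measure E3)) : Prop :=
  ∀ g : Measure E3 → E3 → ENNReal, Measurable (Function.uncurry g) →
    ∫⁻ μ, ∫⁻ y, g μ y ∂μ ∂P = ∫⁻ μ, ∫⁻ y, g (Measure.map (fun z => z - y) μ) (-y) ∂μ ∂P

/-- `E_P[h]`, the mean energy of the root (Bochner integrals, junk value `0`). [folklore] -/
def meanRootEnergy (P : Measure (Measure E3)) : ℝ :=
  ∫ μ, (∫ y, lennardJones ‖y‖ ∂μ) / 2 ∂P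

/-- The (1/100)-close-packed-shell condition at a point `x` of `S`. [folklore] -/
def GoodShell (S : Set E3) (x : E3) : Prop :=
  ∃ a : ℝ, 9 / 10 ≤ a ∧ a ≤ 1 ∧ ∃ T : Finset E3,
    (↑T : Set E3) = (fun y : E3 => y - x) '' {y : E3 | y ∈ S ∧ y ≠ x ∧ dist y x ≤ 5 / 4 * a} ∧
    (ShellCloseTo (a / 100) T (Finset.image (fun v : E3 => a • v) fccKissingPattern) ∨
      ShellCloseTo (a / 100) T (Finset.image (fun v : E3 => a • v) hcpKissingPattern))

/-- Global bond-isomorphism with an ideal Barlow stacking. [folklore] -/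
def BarlowLike (S : Set E3) : Prop :=
  ∃ s : ℤ → ℤ, IsHaggSeq s ∧ ∃ Φ : E3 → E3,
    Set.BijOn Φ (barlowStacking 1 (Real.sqrt (2 / 3)) s) S ∧
    ∀ p ∈ barlowStacking 1 (Real.sqrt (2 / 3)) s, ∀ q ∈ barlowStacking 1 (Real.sqrt (2 / 3)) s,
      (dist p q = 1 ↔ (0 < dist (Φ p) (Φ q) ∧ dist (Φ p) (Φ q) ≤ 28 / 25))

/-- H4 (`Layered P`): a.s. good shells everywhere and Barlow bond-isomorphism. [folklore] -/
def Layered (P : Measure (Measure E3)) : Prop :=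
  ∀ᵐ μ ∂P, ∃ S : Set E3, μ = (Measure.count : Measure E3).restrict S ∧
    (∀ x ∈ S, GoodShell S x) ∧ BarlowLike S

/-- The conclusion at one sample: a rotated relaxed hcp crystal with optimal parameters. [folklore] -/
def IsRelaxedHcp (μ : Measure E3) : Prop :=
  ∃ a h : ℝ, ∃ ha : a ≠ 0, ∃ hh : h ≠ 0, 1 / 2 ≤ a ∧ a ≤ 2 ∧ 1 / 2 ≤ h ∧ h ≤ 2 ∧
    ∃ A : E3 ≃ₗᵢ[ℝ] E3,
      (hcpPeriodicConfiguration ha hh).energyPerParticle lennardJones = eStar ∧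
      μ = (Measure.count : Measure E3).restrict (A '' hcpStacking a h)

/-- **The crux, unbundled** (definitional). [folklore] -/
theorem crux_iff :
    LayeredLawsSelectHcp ↔
      ∀ δ : ℝ, 0 < δ → ∀ P : Measure (Measure E3), IsProbabilityMeasure P →
        Rooted δ P → PointStationary P → meanRootEnergy P ≤ eStar → Layered P →
          ∀ᵐ μ ∂P, IsRelaxedHcp μ :=
  Iff.rfl

/-! ## §1 Dirac laws: measurability of `{count|S}` and integration against `δ_{count|S}` -/

/-- Two measures carried by a countable set `S` and agreeing on its points are equal. [folklore] -/
theorem measure_eq_of_compl_null {S : Set E3} (hS : S.Countable) {μ ν : Measure E3}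
    (hμ : μ Sᶜ = 0) (hν : ν Sᶜ = 0) (h : ∀ x ∈ S, μ {x} = ν {x}) : μ = ν := by
  have hSm : MeasurableSet S := hS.measurableSet
  have key : ∀ ρ : Measure E3, ρ Sᶜ = 0 → ∀ B : Set E3, MeasurableSet B →
      ρ B = ∑' p : ↥(B ∩ S), ρ {(p : E3)} := by
    intro ρ hρ B _
    have h1 : ρ (B \ S) = 0 := measure_mono_null (fun x hx => hx.2) hρ
    have h2 : ρ B = ρ (B ∩ S) := by rw [← measure_inter_add_sdiff B hSm, h1, add_zero]
    rw [h2]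
    calc ρ (B ∩ S) = ρ (⋃ x ∈ B ∩ S, {x}) := by rw [Set.biUnion_of_singleton]
      _ = ∑' p : ↥(B ∩ S), ρ {(p : E3)} :=
          measure_biUnion (hS.mono Set.inter_subset_right)
            (fun x _ y _ hxy => Set.disjoint_singleton.2 hxy) fun x _ => measurableSet_singleton x
  ext B hB
  rw [key μ hμ B hB, key ν hν B hB]
  exact tsum_congr fun p => h p p.2.2

/-- `count|S` gives mass `0` to `Sᶜ` … [folklore] -/
theorem count_restrict_compl (S : Set E3) (hS : MeasurableSet S) :
    (Measure.count : Measure E3).restrict S Sᶜ = 0 := by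
  rw [Measure.restrict_apply hS.compl, Set.compl_inter_self, measure_empty]

/-- … and mass `1` to each point of `S`. [folklore] -/
theorem count_restrict_singleton {S : Set E3} {x : E3} (hx : x ∈ S) :
    (Measure.count : Measure E3).restrict S {x} = 1 := by
  rw [Measure.restrict_apply (measurableSet_singleton x),
    Set.inter_eq_self_of_subset_left (Set.singleton_subset_iff.2 hx), Measure.count_singleton]

/-- **`{count|S}` is a measurable set of measures** for `S` countable: it is cut out by the
countably many conditions `μ Sᶜ = 0`, `μ {x} = 1` (`x ∈ S`). [folklore] -/
theorem measurableSet_singleton_count_restrict {S : Set E3} (hS : S.Countable) :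
    MeasurableSet ({(Measure.count : Measure E3).restrict S} : Set (Measure E3)) := by
  have hSm : MeasurableSet S := hS.measurableSet
  have key : ({(Measure.count : Measure E3).restrict S} : Set (Measure E3)) =
      {μ | μ Sᶜ = 0} ∩ ⋂ x ∈ S, {μ | μ {x} = 1} := by
    ext μ
    simp only [Set.mem_singleton_iff, Set.mem_inter_iff, Set.mem_setOf_eq, Set.mem_iInter]
    constructor
    · rintro rfl
      exact ⟨count_restrict_compl S hSm, fun x hx => count_restrict_singleton hx⟩
    · rintro ⟨h0, h1⟩
      exact measure_eq_of_compl_null hS h0 (count_restrict_compl S hSm) fun x hx => by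
        rw [h1 x hx, count_restrict_singleton hx]
  rw [key]
  exact (Measure.measurable_coe hSm.compl (measurableSet_singleton 0)).inter
    (MeasurableSet.biInter hS fun x _ =>
      Measure.measurable_coe (measurableSet_singleton x) (measurableSet_singleton 1))

/-- A.s. statements under a Dirac law at a measurable atom. [folklore] -/
theorem ae_dirac_of_mem {ν : Measure E3} (hν : MeasurableSet ({ν} : Set (Measure E3)))
    {p : Measure E3 → Prop} (hp : p ν) : ∀ᵐ μ ∂(Measure.dirac ν), p μ := by
  rw [ae_iff]
  have hsub : {μ : Measure E3 | ¬ p μ} ⊆ ({ν} : Set (Measure E3))ᶜ := fun μ hμ hμν =>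
    hμ (by rw [Set.mem_singleton_iff.1 hμν]; exact hp)
  refine measure_mono_null hsub ?_
  rw [Measure.dirac_apply' ν hν.compl]
  simp

/-- Conversely, an a.s. statement under `δ_ν` holds at `ν` (no measurability needed). [folklore] -/
theorem of_ae_dirac {ν : Measure E3} {p : Measure E3 → Prop}
    (h : ∀ᵐ μ ∂(Measure.dirac ν), p μ) : p ν := by
  by_contra hν
  rw [ae_iff] at h
  have : Measure.dirac ν {μ | ¬ p μ} = 1 := Measure.dirac_apply_of_mem hν
  rw [h] at this
  exact zero_ne_one this

/-- `∫⁻ F dδ_ν = F ν` at a measurable atom (no measurability of `F`). [folklore] -/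
theorem lintegral_dirac_of_mem {ν : Measure E3} (hν : MeasurableSet ({ν} : Set (Measure E3)))
    (F : Measure E3 → ENNReal) : ∫⁻ μ, F μ ∂(Measure.dirac ν) = F ν := by
  have h : F =ᵐ[Measure.dirac ν] fun _ => F ν :=
    ae_dirac_of_mem hν (p := fun μ => F μ = F ν) rfl
  rw [lintegral_congr_ae h, lintegral_const, measure_univ, mul_one]

/-- `∫ F dδ_ν = F ν` at a measurable atom (no measurability of `F`). [folklore] -/
theorem integral_dirac_of_mem {ν : Measure E3} (hν : MeasurableSet ({ν} : Set (Measure E3)))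
    (F : Measure E3 → ℝ) : ∫ μ, F μ ∂(Measure.dirac ν) = F ν := by
  have h : F =ᵐ[Measure.dirac ν] fun _ => F ν :=
    ae_dirac_of_mem hν (p := fun μ => F μ = F ν) rfl
  rw [integral_congr_ae h, integral_const]
  simp

/-! ## §2 Counting measures of lattices are point-stationary Dirac laws -/

/-- A measurable bijection preserving `S` preserves `count|S`. [folklore] -/
theorem map_count_restrict_eq (e : E3 ≃ᵐ E3) {S : Set E3} (hS : S.Countable)
    (he : e ⁻¹' S = S) :
    Measure.map e ((Measure.count : Measure E3).restrict S) =
      (Measure.count : Measure E3).restrict S := by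
  have hSm : MeasurableSet S := hS.measurableSet
  ext t ht
  rw [MeasurableEquiv.map_apply, Measure.restrict_apply (e.measurable ht),
    Measure.restrict_apply ht]
  have hu : MeasurableSet (t ∩ S) := ht.inter hSm
  calc Measure.count (e ⁻¹' t ∩ S) = Measure.count (e ⁻¹' (t ∩ S)) := by
        rw [Set.preimage_inter, he]
    _ = (e ⁻¹' (t ∩ S)).encard := Measure.count_apply (e.measurable hu)
    _ = (t ∩ S).encard := by rw [← MeasurableEquiv.image_symm, e.symm.injective.encard_image]
    _ = Measure.count (t ∩ S) := (Measure.count_apply hu).symm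

/-- **The Dirac law at the counting measure of a countable additive subgroup of `ℝ³` is
point-stationary**: `θ_y (count|L) = count|L` for `y ∈ L`, and `L = −L`. [folklore] -/
theorem pointStationary_dirac_addSubgroup (L : AddSubgroup E3) (hL : (L : Set E3).Countable) :
    PointStationary (Measure.dirac ((Measure.count : Measure E3).restrict (L : Set E3))) := by
  set ν := (Measure.count : Measure E3).restrict (L : Set E3) with hνdef
  have hν : MeasurableSet ({ν} : Set (Measure E3)) := measurableSet_singleton_count_restrict hL
  have hLm : MeasurableSet (L : Set E3) := hL.measurableSet
  intro g _
  rw [lintegral_dirac_of_mem hν, lintegral_dirac_of_mem hν]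
  -- on `L`, shifting by `-y` fixes `count|L`
  have h1 : ∀ y ∈ (L : Set E3), Measure.map (fun z => z - y) ν = ν := fun y hy => by
    have : (fun z : E3 => z - y) = ⇑(MeasurableEquiv.subRight y) := rfl
    rw [this]
    refine map_count_restrict_eq _ hL ?_
    ext z
    simp only [Set.mem_preimage, SetLike.mem_coe]
    change z - y ∈ L ↔ z ∈ L
    exact ⟨fun h => by simpa using L.add_mem h hy, fun h => L.sub_mem h hy⟩
  have h2 : (fun y => g (Measure.map (fun z => z - y) ν) (-y)) =ᵐ[ν] fun y => g ν (-y) := by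
    filter_upwards [ae_restrict_mem hLm] with y hy
    rw [h1 y hy]
  rw [lintegral_congr_ae h2]
  -- `count|L` is invariant under `y ↦ -y`
  have h3 : Measure.map (MeasurableEquiv.neg E3) ν = ν := by
    refine map_count_restrict_eq _ hL ?_
    ext z
    simp only [Set.mem_preimage, SetLike.mem_coe]
    change -z ∈ L ↔ z ∈ L
    exact neg_mem_iff
  calc ∫⁻ y, g ν y ∂ν = ∫⁻ y, g ν y ∂(Measure.map (MeasurableEquiv.neg E3) ν) := by rw [h3]
    _ = ∫⁻ y, g ν ((MeasurableEquiv.neg E3) y) ∂ν := lintegral_map_equiv _ _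
    _ = ∫⁻ y, g ν (-y) ∂ν := rfl

end Summit.AtomisticToContinuum.Crystallization.Theorems.LayeredLawsSelectHcp.Negative.DiracLaws

end
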